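import Summits.QuantumFields.BalabanUV.Beta.FP.MixLoopPowerCounting
import Summits.QuantumFields.BalabanUV.Beta.FP.AveragingJetLettersRooted

/-!
# `Beta/FP/WindowedBlockMass` — road «FP» (binder row D1), rows RHOA-6b′ → RHOA-6c′∕RHOA-6e junction: THE EXPONENTIALLY WINDOWED MASS LETTER (M) FROM
# PER-BLOCK TOTALS + BLOCK LOCALITY — `Σ_{b∈S} e^{−(δ∕n)‖b−p‖∞}·Σ_{u∈Y} m_u(b) ≤ Λ·e^{δR}·e^{δ}·(1 + 480·e^{δ∕2}(2∕δ)⁴)` for ANY family of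
# nonnegative per-block mass functions with per-block totals `≤ Λ` and support within `R·n` of the block anchor ([folklore] lattice bookkeeping on `ℤ⁴`)

HONEST FRAMING (cell `pub-balaban`, β sub-cell, verbatim): discharging `BetaPertH` makes Bałaban's UV stability UNCONDITIONAL — a real constructive-QFT
result; it is NOT the continuum limit and NOT the Clay problem.  THIS MODULE is elementary [folklore] real analysis on `ℤ⁴` over FILE A
`FP/MixLoopPowerCounting` BY NAME (`sum_exp_le` at the COARSE scale `n = 1`; the (M) letter of the owner's RHOA-6c′ `FP/MixLoopPowerCountingMass` is the
target shape), the tree's sup-norm letters (`BlockLegs.supNorm_add_le_real`∕`supNorm_sub_le_real`∕`supNorm_nsmul_real`) and, in §3 only, RHOA-6b′'s `FP/AveragingJetLettersRooted` (`mass₁`, `blkW`, `blkBg`, `blk_massFun_le`) BY NAME;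
abstract mass functions, every letter displayed; it asserts
nothing about Bałaban's objects, cites nothing, mints no `Prop` fact, has no `def`, 0 sorry.  NOT `Mix_n = O(1)` (row RHOA-6e assembles), NOT hbook, NOT D1,
NOT BetaPertH, NOT continuum, NOT Clay.
HONEST DEPENDENCY: continuum YM on T⁴ ⇐ BetaPertH ∧ nine spine estimates (0/9 proved); BetaPertH ⇐ (D1) ∧ (D4) ∧ CAP+tail; G-an2-4 gates asym, D1 and NE2/3/4.

ABSOLUTE RULE (cell charter, verbatim): «No internally-minted statement may enter as a cited fact. Every hypothesis is either kernel-proved in this package or a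
verbatim quotation of a PUBLISHED theorem with page reference. The manuscript(s) under audit are NOT citable for their own disputed steps — they are the thing under
adjudication; programme-internal (2001/route/tribunal) claims are never citable.»

WHY (owner GO l.25401 remark (i) on RHOA-6b′): «the (M)-letter of `MixLoopPowerCountingMass.coarse_mix2_secondMoment_le` is an exponentially windowed sum of
`m`; the per-block total is what instantiates it».  RHOA-6b′ (`FP/AveragingJetLettersRooted`, p245346) delivers, per coarse bond `u`, a MASS FUNCTION
`m_u = mass₁ …` with `Σ_{b∈S} m_u(b) ≤ (ℓ₀+n)·Σp` for EVERY finite window (`blk_massFun_le`) and support near the block (`blk_support` + the radial rule's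
radius).  THIS FILE is the instance-free step in between: per-block totals + block locality ⟹ the windowed letter, with the coarse lattice sum paid ONCE at
scale `n = 1` (no power of `n`).

THE LETTERS (displayed; insertion LABELS `ℓ : B` placed at fine points by `pos : B → Pt` — `B = Pt`, `pos = id` is the point-indexed form): (m) `0 ≤ m u ℓ`;
(T) `Σ_{ℓ∈S} m u ℓ ≤ Λ` for every coarse `u` and every finite `S`; (L) `m u ℓ ≠ 0 ⟹ ‖pos ℓ − n•u‖∞ ≤ R·n`.
CONTENT: §1 `exists_coarse_anchor` (every fine `p` is within `n` of some `n•u₀`: floor division), `exp_window_le_of_near` (a window weight at a point near the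
block `u` is at most `e^{δR}` times the weight at the anchor), **`sum_coarse_exp_le`** (`Σ_{u∈Y} e^{−(δ∕n)‖n•u − p‖} ≤ e^{δ}·(1 + 480·e^{δ∕2}(2∕δ)⁴)`, n-FREE);
§2 **`windowedMass_le`** (the display in the title, for ALL finite `S`, `Y` and every centre `p`) and **`windowedMass_le_half`** (the rate `δ∕(2n)` of (M) verbatim,
bound `Λ·e^{δR∕2}·e^{δ∕2}·(1 + 480·e^{δ∕4}(4∕δ)⁴)` — fed BY NAME, no arithmetic at the junction; owner ask l.25773);
§3 THE INSTANCE FOR RHOA-6b′'s BLOCK FAMILIES (owner word l.25773: position map + radial radius as HYPOTHESES on the abstract path rules, `R₀` free):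
`exists_of_mass₁_ne_zero`, `supNorm_pt_le` (straight bonds within `2n` of the anchor), **`blk_mass₁_local`** ((L) with `R₀ ≥ 2` from `pos (strB z) = z` + the
radial letter `‖pos ℓ − n•u‖∞ ≤ R₀·n`), **`blk_windowedMass_le_half`** ((M) for `m u = mass₁ (blkW n p) (blkBg n μ u rad strB)` with `Λ = (ℓ₀+n)·Σp` from
`AveragingJetLettersRooted.blk_massFun_le`).  Instance values of `pos`, `R₀`, `ℓ₀` come from the path rules (comb ∕ S_D staircases) — RHOA-6e's bookkeeping.
Provenance: cross-cell idle-seat kernel duty NE7b → β∕D1, unit `b2b-balaban-t4-ne7b-formalise-leaf-02` gen 22, 2026-08-21; owner «GO, THIS SHAPE» l.25773;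
«not in print; our bookkeeping»; no existing file touched.
-/

noncomputable section

namespace Summit.QuantumFields.BalabanUV.Beta.FP.WindowedBlockMass

open Finset Real
open scoped BigOperators
open Literature.MathematicalPhysics.QuantumFieldTheory.Balaban1983to89.Beta.DyadicShell (Pt supNorm supNorm_le_iff)
open Literature.MathematicalPhysics.QuantumFieldTheory.Balaban1983to89.Beta.BlockLegs (supNorm_sub_le_real supNorm_add_le_real supNorm_nsmul_real)
open Summit.QuantumFields.BalabanUV.Beta.FP.MixLoopPowerCounting (sum_exp_le supNorm_cast_nonneg)

/-! ## §1 Coarse anchors and the coarse lattice sum at the fine scale -/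

/-- [folklore] FLOOR BLOCKS: every fine point `p ∈ ℤ⁴` lies within sup-distance `n` of a coarse anchor `n•u₀` (`n ≥ 1`). -/
theorem exists_coarse_anchor {n : ℕ} (hn : 1 ≤ n) (p : Pt) : ∃ u₀ : Pt, supNorm (p - (n : ℤ) • u₀) ≤ n := by
  refine ⟨fun i => p i / (n : ℤ), supNorm_le_iff.mpr fun i => ?_⟩
  have hn' : (0 : ℤ) < (n : ℤ) := by exact_mod_cast hn
  have h1 : 0 ≤ p i % (n : ℤ) := Int.emod_nonneg _ hn'.ne'
  have h2 : p i % (n : ℤ) < (n : ℤ) := Int.emod_lt_of_pos _ hn'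
  have h3 : (p - (n : ℤ) • fun i => p i / (n : ℤ)) i = p i % (n : ℤ) := by
    simp only [Pi.sub_apply, Pi.smul_apply, smul_eq_mul]
    rw [Int.emod_def]
  rw [h3]
  have : (p i % (n : ℤ)).natAbs < n := by
    rw [← Int.ofNat_lt, Int.natAbs_of_nonneg h1]; exact h2
  exact this.le

/-- [folklore] A WINDOW WEIGHT NEAR THE BLOCK: `‖b − n•u‖∞ ≤ R·n` ⟹ `e^{−(δ∕n)‖b − p‖} ≤ e^{δR}·e^{−(δ∕n)‖n•u − p‖}` (`δ ≥ 0`, `n ≥ 1`). -/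
theorem exp_window_le_of_near {δ : ℝ} (hδ : 0 ≤ δ) {n : ℕ} (hn : 1 ≤ n) {R : ℝ} {b u p : Pt}
    (hb : (supNorm (b - (n : ℤ) • u) : ℝ) ≤ R * n) :
    Real.exp (-(δ / n) * (supNorm (b - p) : ℝ)) ≤ Real.exp (δ * R) * Real.exp (-(δ / n) * (supNorm ((n : ℤ) • u - p) : ℝ)) := by
  have hn' : (0 : ℝ) < n := by exact_mod_cast hn
  have htri : (supNorm ((n : ℤ) • u - p) : ℝ) ≤ supNorm (b - p) + supNorm (b - (n : ℤ) • u) := by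
    have e : (n : ℤ) • u - p = (b - p) - (b - (n : ℤ) • u) := by abel
    rw [e]; exact supNorm_sub_le_real _ _
  rw [← Real.exp_add]
  refine Real.exp_le_exp.mpr ?_
  have h1 : (δ / n) * (supNorm ((n : ℤ) • u - p) : ℝ) ≤ (δ / n) * (supNorm (b - p) : ℝ) + (δ / n) * (R * n) := by
    have h' : (supNorm ((n : ℤ) • u - p) : ℝ) ≤ supNorm (b - p) + R * n := by linarith
    have := mul_le_mul_of_nonneg_left h' (div_nonneg hδ hn'.le)
    linarith [this]
  have h2 : (δ / n) * (R * n) = δ * R := by field_simp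
  linarith [h1, h2]

/-- [folklore] **THE COARSE LATTICE SUM AT THE FINE SCALE, n-FREE**: for every finite `Y ⊆ ℤ⁴` of coarse sites and every fine centre `p`,
`Σ_{u∈Y} e^{−(δ∕n)‖n•u − p‖∞} ≤ e^{δ}·(1 + 480·e^{δ∕2}·(2∕δ)⁴)` (anchor `p` to its floor block, then FILE A's `sum_exp_le` at scale `1`). -/
theorem sum_coarse_exp_le {δ : ℝ} (hδ : 0 < δ) {n : ℕ} (hn : 1 ≤ n) (Y : Finset Pt) (p : Pt) :
    ∑ u ∈ Y, Real.exp (-(δ / n) * (supNorm ((n : ℤ) • u - p) : ℝ))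
      ≤ Real.exp δ * (1 + 480 * Real.exp (δ / 2) * (2 / δ) ^ 4) := by
  classical
  obtain ⟨u₀, hu₀⟩ := exists_coarse_anchor hn p
  have hn' : (0 : ℝ) < n := by exact_mod_cast hn
  -- each term: `‖n•u − p‖ ≥ n‖u − u₀‖ − n`
  have hterm : ∀ u, Real.exp (-(δ / n) * (supNorm ((n : ℤ) • u - p) : ℝ)) ≤ Real.exp δ * Real.exp (-δ * (supNorm (u - u₀) : ℝ)) := by
    intro u
    have htri : (n : ℝ) * supNorm (u - u₀) ≤ supNorm ((n : ℤ) • u - p) + supNorm (p - (n : ℤ) • u₀) := by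
      have hz : ((n : ℝ) * supNorm (u - u₀) : ℝ) = supNorm ((n : ℤ) • (u - u₀)) := by
        rw [natCast_zsmul, supNorm_nsmul_real]   -- = the owner's `MixLoopPowerCountingMass.supNorm_zsmul_natCast_real`, inlined (olean lag)
      rw [hz]
      have e : (n : ℤ) • (u - u₀) = ((n : ℤ) • u - p) + (p - (n : ℤ) • u₀) := by rw [smul_sub]; abel
      rw [e]; exact supNorm_add_le_real _ _
    have h0 : (supNorm (p - (n : ℤ) • u₀) : ℝ) ≤ n := by exact_mod_cast hu₀
    rw [← Real.exp_add]
    refine Real.exp_le_exp.mpr ?_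
    have h1 : (δ / n) * ((n : ℝ) * supNorm (u - u₀)) ≤ (δ / n) * (supNorm ((n : ℤ) • u - p) : ℝ) + (δ / n) * n := by
      have h' : (n : ℝ) * supNorm (u - u₀) ≤ supNorm ((n : ℤ) • u - p) + n := by linarith
      have := mul_le_mul_of_nonneg_left h' (div_nonneg hδ.le hn'.le)
      linarith [this]
    have h2 : (δ / n) * ((n : ℝ) * supNorm (u - u₀)) = δ * supNorm (u - u₀) := by field_simp
    have h3 : (δ / n) * (n : ℝ) = δ := by field_simp
    linarith [h1, h2, h3]
  -- sum, reindex by the translation `u ↦ u − u₀`, and apply the engine at scale 1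
  have hsum : ∑ u ∈ Y, Real.exp (-δ * (supNorm (u - u₀) : ℝ)) = ∑ z ∈ Y.image (fun u => u - u₀), Real.exp (-δ * (supNorm z : ℝ)) := by
    rw [Finset.sum_image (fun u _ v _ h => sub_left_injective h)]
  have hengine := sum_exp_le hδ (le_refl 1) (Y.image fun u => u - u₀)
  simp only [Nat.cast_one, div_one, one_pow, mul_one] at hengine
  calc ∑ u ∈ Y, Real.exp (-(δ / n) * (supNorm ((n : ℤ) • u - p) : ℝ))
      ≤ ∑ u ∈ Y, Real.exp δ * Real.exp (-δ * (supNorm (u - u₀) : ℝ)) := Finset.sum_le_sum fun u _ => hterm u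
    _ = Real.exp δ * ∑ z ∈ Y.image (fun u => u - u₀), Real.exp (-δ * (supNorm z : ℝ)) := by rw [← Finset.mul_sum, hsum]
    _ ≤ Real.exp δ * (1 + 480 * Real.exp (δ / 2) * (2 / δ) ^ 4) := mul_le_mul_of_nonneg_left hengine (Real.exp_pos _).le

/-! ## §2 The windowed mass letter from per-block totals and block locality -/

/-- **(M) FROM PER-BLOCK TOTALS + BLOCK LOCALITY** ([folklore]; abstract insertion LABELS `ℓ : B` placed at fine points by `pos`): nonnegative per-block
mass functions `m u ·` with (T) `Σ_{ℓ∈S} m u ℓ ≤ Λ` (every coarse `u`, every finite `S`) and (L) `m u ℓ ≠ 0 ⟹ ‖pos ℓ − n•u‖∞ ≤ R·n` satisfy, for ALL finite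
`S`, `Y` and every fine centre `p`, `Σ_{ℓ∈S} e^{−(δ∕n)‖pos ℓ − p‖∞}·(Σ_{u∈Y} m u ℓ) ≤ Λ·e^{δR}·(e^{δ}·(1 + 480·e^{δ∕2}(2∕δ)⁴))` — no power of `n`
(`B = Pt`, `pos = id` is the point-indexed form). -/
theorem windowedMass_le {B : Type*} (pos : B → Pt) {δ : ℝ} (hδ : 0 < δ) {n : ℕ} (hn : 1 ≤ n) {m : Pt → B → ℝ}
    (hm0 : ∀ u ℓ, 0 ≤ m u ℓ) {Λ R : ℝ} (hT : ∀ (u : Pt) (S : Finset B), ∑ ℓ ∈ S, m u ℓ ≤ Λ)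
    (hL : ∀ u ℓ, m u ℓ ≠ 0 → (supNorm (pos ℓ - (n : ℤ) • u) : ℝ) ≤ R * n) (S : Finset B) (Y : Finset Pt) (p : Pt) :
    ∑ ℓ ∈ S, Real.exp (-(δ / n) * (supNorm (pos ℓ - p) : ℝ)) * ∑ u ∈ Y, m u ℓ
      ≤ Λ * Real.exp (δ * R) * (Real.exp δ * (1 + 480 * Real.exp (δ / 2) * (2 / δ) ^ 4)) := by
  have hΛ : 0 ≤ Λ := by simpa using hT p ∅
  -- swap the sums and bound each block's window by `e^{δR}·(anchor weight)·Λ`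
  have hblock : ∀ u ∈ Y, ∑ ℓ ∈ S, Real.exp (-(δ / n) * (supNorm (pos ℓ - p) : ℝ)) * m u ℓ
      ≤ Real.exp (δ * R) * Real.exp (-(δ / n) * (supNorm ((n : ℤ) • u - p) : ℝ)) * Λ := by
    intro u _
    have hpt : ∀ ℓ ∈ S, Real.exp (-(δ / n) * (supNorm (pos ℓ - p) : ℝ)) * m u ℓ
        ≤ Real.exp (δ * R) * Real.exp (-(δ / n) * (supNorm ((n : ℤ) • u - p) : ℝ)) * m u ℓ := by
      intro ℓ _
      by_cases hmb : m u ℓ = 0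
      · rw [hmb, mul_zero, mul_zero]
      · exact mul_le_mul_of_nonneg_right (exp_window_le_of_near hδ.le hn (hL u ℓ hmb)) (hm0 u ℓ)
    calc ∑ ℓ ∈ S, Real.exp (-(δ / n) * (supNorm (pos ℓ - p) : ℝ)) * m u ℓ
        ≤ ∑ ℓ ∈ S, Real.exp (δ * R) * Real.exp (-(δ / n) * (supNorm ((n : ℤ) • u - p) : ℝ)) * m u ℓ := Finset.sum_le_sum hpt
      _ = Real.exp (δ * R) * Real.exp (-(δ / n) * (supNorm ((n : ℤ) • u - p) : ℝ)) * ∑ ℓ ∈ S, m u ℓ := by rw [Finset.mul_sum]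
      _ ≤ _ := mul_le_mul_of_nonneg_left (hT u S) (by positivity)
  calc ∑ ℓ ∈ S, Real.exp (-(δ / n) * (supNorm (pos ℓ - p) : ℝ)) * ∑ u ∈ Y, m u ℓ
      = ∑ u ∈ Y, ∑ ℓ ∈ S, Real.exp (-(δ / n) * (supNorm (pos ℓ - p) : ℝ)) * m u ℓ := by
        rw [Finset.sum_comm]; simp_rw [Finset.mul_sum]
    _ ≤ ∑ u ∈ Y, Real.exp (δ * R) * Real.exp (-(δ / n) * (supNorm ((n : ℤ) • u - p) : ℝ)) * Λ := Finset.sum_le_sum hblock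
    _ = Λ * Real.exp (δ * R) * ∑ u ∈ Y, Real.exp (-(δ / n) * (supNorm ((n : ℤ) • u - p) : ℝ)) := by
        rw [Finset.mul_sum]; exact Finset.sum_congr rfl fun u _ => by ring
    _ ≤ Λ * Real.exp (δ * R) * (Real.exp δ * (1 + 480 * Real.exp (δ / 2) * (2 / δ) ^ 4)) :=
        mul_le_mul_of_nonneg_left (sum_coarse_exp_le hδ hn Y p) (by positivity)

/-- **THE HALF-RATE FORM, fed BY NAME to RHOA-6c′'s (M)** (window weight `e^{−(δ∕(2n))‖pos ℓ − p‖∞}` exactly as in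
`MixLoopPowerCountingMass.coarse_mix2_secondMoment_le`; owner ask l.25773): `≤ Λ·e^{δR∕2}·(e^{δ∕2}·(1 + 480·e^{δ∕4}·(4∕δ)⁴))`. [folklore] -/
theorem windowedMass_le_half {B : Type*} (pos : B → Pt) {δ : ℝ} (hδ : 0 < δ) {n : ℕ} (hn : 1 ≤ n) {m : Pt → B → ℝ}
    (hm0 : ∀ u ℓ, 0 ≤ m u ℓ) {Λ R : ℝ} (hT : ∀ (u : Pt) (S : Finset B), ∑ ℓ ∈ S, m u ℓ ≤ Λ)
    (hL : ∀ u ℓ, m u ℓ ≠ 0 → (supNorm (pos ℓ - (n : ℤ) • u) : ℝ) ≤ R * n) (S : Finset B) (Y : Finset Pt) (p : Pt) :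
    ∑ ℓ ∈ S, Real.exp (-(δ / (2 * n)) * (supNorm (pos ℓ - p) : ℝ)) * ∑ u ∈ Y, m u ℓ
      ≤ Λ * Real.exp (δ * R / 2) * (Real.exp (δ / 2) * (1 + 480 * Real.exp (δ / 4) * (4 / δ) ^ 4)) := by
  have h := windowedMass_le pos (half_pos hδ) hn hm0 hT hL S Y p
  have e1 : ∀ ℓ, Real.exp (-(δ / 2 / n) * (supNorm (pos ℓ - p) : ℝ)) = Real.exp (-(δ / (2 * n)) * (supNorm (pos ℓ - p) : ℝ)) := by
    intro ℓ; rw [div_div]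
  have e2 : Real.exp (δ / 2 * R) = Real.exp (δ * R / 2) := by ring_nf
  have e3 : Real.exp (δ / 2 / 2) = Real.exp (δ / 4) := by ring_nf
  have e4 : (2 / (δ / 2) : ℝ) = 4 / δ := by field_simp; ring
  simp only [e1, e2, e3, e4] at h
  exact h


/-! ## §3 The instance for RHOA-6b′'s block families (owner word l.25773: position map + radial radius as hypotheses) -/

section Block

open Literature.MathematicalPhysics.QuantumFieldTheory.Balaban1983to89.Beta.AxialBlockWeights (idx pt mem_fineBlock pt_apply)
open Summit.QuantumFields.BalabanUV.Beta.FP.AveragingJetLetters (mem_idx_iff)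
open Summit.QuantumFields.BalabanUV.Beta.FP.AveragingJetLettersRooted (mass₁ blkW blkBg blkW_nonneg blk_massFun_le)

variable {σ : Type*} [Fintype σ] {B : Type*} [DecidableEq B]

omit [DecidableEq B] in
/-- [folklore] a nonzero mass-function entry is witnessed by an event whose background word contains the label. -/
theorem exists_of_mass₁_ne_zero {ι : Type*} [Fintype ι] [DecidableEq B] {ω : ι → ℝ} {bg : ι → List B} {ℓ : B}
    (h : mass₁ ω bg ℓ ≠ 0) : ∃ e, ℓ ∈ bg e := by
  by_contra hne
  push Not at hne
  apply h
  refine Finset.sum_eq_zero fun e _ => ?_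
  rw [List.count_eq_zero.mpr (hne e), Nat.cast_zero, mul_zero]

/-- [folklore] the straight-segment bonds of block `u` sit within `2n` of the anchor: `‖pt μ (x′, j)‖∞ ≤ 2n` for `x′` in the fine block, `j < n`. -/
theorem supNorm_pt_le {n : ℕ} (μ : Fin 4) (q : ↥(idx n)) {j : ℕ} (hj : j < q.1.2) : supNorm (pt μ (q.1.1, j)) ≤ 2 * n := by
  have hq := mem_idx_iff.mp q.2
  have hx := mem_fineBlock.mp hq.1
  refine supNorm_le_iff.mpr fun i => ?_
  have h1 := hx i
  have hjn : j < n := lt_trans hj hq.2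
  have hv : pt μ (q.1.1, j) i = q.1.1 i + if i = μ then (j : ℤ) else 0 := by rw [pt_apply]
  rw [hv]
  split_ifs <;> omega

/-- **(L) FOR THE BLOCK FAMILY** ([folklore]): with a position map `pos : B → Pt` under which the straight labels sit at their base points
(`pos (strB z) = z`) and every radial letter of block `u` lies within `R₀·n` of the anchor `n•u` (HYPOTHESIS on the abstract path rules; `2 ≤ R₀`),
a nonzero `mass₁` entry of block `u` lies within `R₀·n` of `n•u`. -/
theorem blk_mass₁_local {n : ℕ} (μ : Fin 4) (u : Pt) {p : σ → ℝ} {rad : σ → Pt → Pt → List B} {strB : Pt → B} (pos : B → Pt)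
    {R₀ : ℝ} (hR₀ : 2 ≤ R₀) (hstr : ∀ z, pos (strB z) = z)
    (hradR : ∀ (s : σ) (q : ↥(idx n)) (ℓ : B), ℓ ∈ rad s u q.1.1 → (supNorm (pos ℓ - (n : ℤ) • u) : ℝ) ≤ R₀ * n) {ℓ : B}
    (h : mass₁ (blkW n p) (blkBg n μ u rad strB) ℓ ≠ 0) : (supNorm (pos ℓ - (n : ℤ) • u) : ℝ) ≤ R₀ * n := by
  obtain ⟨e, he⟩ := exists_of_mass₁_ne_zero h
  unfold blkBg at he
  rcases List.mem_append.mp he with he | he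
  · exact hradR e.2 e.1 ℓ he
  · obtain ⟨j, hj, rfl⟩ := List.mem_map.mp he
    rw [hstr]
    have hj' : j < e.1.1.2 := List.mem_range.mp hj
    have hz : (n • u + pt μ (e.1.1.1, j)) - (n : ℤ) • u = pt μ (e.1.1.1, j) := by
      rw [← natCast_zsmul u n]; abel
    rw [hz]
    have h2 : (supNorm (pt μ (e.1.1.1, j)) : ℝ) ≤ 2 * n := by exact_mod_cast supNorm_pt_le μ e.1 hj'
    have hn0 : (0 : ℝ) ≤ n := Nat.cast_nonneg n
    nlinarith

/-- **(M) FOR RHOA-6b′'s BLOCK FAMILIES, HALF RATE** ([folklore]): the per-block mass functions `mass₁ (blkW n p) (blkBg n μ u rad strB)` of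
`AveragingJetLettersRooted` satisfy RHOA-6c′'s windowed letter with `Λ = (ℓ₀ + n)·Σ_σ p σ` (`blk_massFun_le`) and the radius `R₀` of the path rules:
`Σ_{ℓ∈S} e^{−(δ∕(2n))‖pos ℓ − c‖∞}·Σ_{u∈Y} mass₁^{(u)} ℓ ≤ (ℓ₀+n)·Σp·e^{δR₀∕2}·(e^{δ∕2}·(1 + 480·e^{δ∕4}(4∕δ)⁴))`, ALL finite `S`, `Y`, every centre `c`. -/
theorem blk_windowedMass_le_half {δ : ℝ} (hδ : 0 < δ) {n : ℕ} (hn : 1 ≤ n) (μ : Fin 4) {p : σ → ℝ} (hp : ∀ s, 0 ≤ p s)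
    {rad : σ → Pt → Pt → List B} {strB : Pt → B} {ℓ₀ : ℕ} (hrad : ∀ s u x', (rad s u x').length ≤ ℓ₀) (pos : B → Pt)
    {R₀ : ℝ} (hR₀ : 2 ≤ R₀) (hstr : ∀ z, pos (strB z) = z)
    (hradR : ∀ (s : σ) (u : Pt) (q : ↥(idx n)) (ℓ : B), ℓ ∈ rad s u q.1.1 → (supNorm (pos ℓ - (n : ℤ) • u) : ℝ) ≤ R₀ * n)
    (S : Finset B) (Y : Finset Pt) (c : Pt) :
    ∑ ℓ ∈ S, Real.exp (-(δ / (2 * n)) * (supNorm (pos ℓ - c) : ℝ)) * ∑ u ∈ Y, mass₁ (blkW n p) (blkBg n μ u rad strB) ℓ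
      ≤ (((ℓ₀ + n : ℕ) : ℝ) * ∑ s, p s) * Real.exp (δ * R₀ / 2) * (Real.exp (δ / 2) * (1 + 480 * Real.exp (δ / 4) * (4 / δ) ^ 4)) :=
  windowedMass_le_half pos hδ hn (m := fun u ℓ => mass₁ (blkW n p) (blkBg n μ u rad strB) ℓ)
    (fun _ ℓ => AveragingJetLettersRooted.mass₁_nonneg (blkW_nonneg n hp) ℓ)
    (fun u S => blk_massFun_le hn hp (hrad · u ·) S) (fun u _ h => blk_mass₁_local μ u pos hR₀ hstr (fun s q ℓ' h' => hradR s u q ℓ' h') h) S Y c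

end Block

end Summit.QuantumFields.BalabanUV.Beta.FP.WindowedBlockMass

end
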